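import Literature.MathematicalPhysics.QuantumFieldTheory.Balaban1983to89.B15Prop1IntrinsicOfFun

/-!
# `Balaban1983to89.B15Prop1OneSidedIneq17OfFun` — [Balaban1989LargeFieldI] Prop. 1 p. 194 ∕ [Balaban1989LargeFieldII] p. 357, (1.7)–(1.9) p. 358:
# THE N12∕s1 ENDPOINT CHAIN RE-ISSUED WITH THE ONE-SIDED, γ₀-GENERIC (1.7) LETTER `h17` IN PLACE OF THE TWO-SIDED `hlead` — print's (1.7) AS
# DISPLAYED («it is simple to estimate the lower bound», p. 357), the currency the D-0149 U2 lane (second variation ∕ linearised minimiser ∕ localized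
# Federbush inequality) reaches at `n′ = 1`, γ₀ = 1 with no further estimate

Honest framing: statement-level skeleton of published theorems with citation tags; proofs where landed; nothing here is a claim about the Yang–Mills mass gap.

Cell pub-ymgap, HUMAN RULINGS D-0062 ∕ D-0149, seat `pub-ymgap-dag-n12-c` (R134 (a), s1 of node N12 = [B15]; g16).  PDFs held: `paper:balaban1989-cmp122-large-field-ii`
(pp. 357–359 = PDF 3–5, re-read first-hand: render p0003 «Consider now the quadratic form in the exponential in (1.2). This quadratic form is positive definite,
and it is simple to estimate the lower bound … Now the leading quadratic form is equal to (B′, Δ_kB′) defined by (1.65), (1.66) [10]. Using the bound (1.67) [10]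
for this form, we obtain (1.7)»).

WHY (seat n12-w4's LOCATED-1, pub-ymgap INBOX 2026-08-27T23:19Z, adopted by this lane).  Every N12∕s1 endpoint from `B15Prop1LocalLettersOfFun` up to
`B15Prop1JointHolomorphyFromBackground` (p583244) displays the (L2) letter TWO-SIDEDLY, `hlead : |⟪X, D(rGrad g)(0)X⟫ − Σ_a formDk n′ (ιA X)_a| ≤ Cerr‖X‖²`
(closeness of the slice Hessian of print's function (1.77) to the GLOBAL unweighted variational form (1.65)–(1.66) [10]), although the kernel consumes only its
LOWER half: `B15Prop1LocalLettersRecord.prop1Printed_lfVarOn_su2_box_G0_of_167_local` turns `hlead` + (1.67) (`B15Prop1SliceIneq167.circ_le_sum_formDk`) into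
the γ₀-generic one-sided letter `h17 : γ₀·circ(X) − Cerr‖X‖² ≤ Q(X)` of the root `B15Prop1LocalLettersSU2Box.prop1Printed_lfVarOn_su2_box_G0_of_17_ext193_local` at
γ₀ = (4∕π²)^{d+2}, and (1.8)–(1.9) follow from that half alone (the intrinsic layers use it a second time, for the Hessian coercivity behind the analytic clause,
through `B15Prop1IntrinsicAnalyticAtRecord.hessian_coercive_of_hlead` — again the lower half).  The U2 lane's combined output (n12-w2 `Node00.WilsonActionSecondVariation`
p583639, n12-w3 `B11Eq177CriticalFamilyDerivative` p584027, n12-w4 `B16Ineq17LocalFederbush` p584067) is two-sided about the FLAT `Z`-LOCAL ζ₀-weighted form and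
therefore ONE-SIDED about `formDk`: its lower half at `n′ = 1`, γ₀ = 1 is «zero estimates away» (localized Federbush + `formDk 1 = d1Sq`), whereas the upper half
needs print's two replacement steps («replacing the minimizer … by the k-th minimizer defined on the whole lattice, and the function ζ₀ by the function identically
equal to 1») = the exponential decay of the `Z`-local linearised minimiser, an L-sized estimate no seat owns.  THIS MODULE re-issues the seven theorems of the chain
from the root up with the root's own letter — γ₀ a parameter, `h17` one-sided, `hsm`∕`hγle` in γ₀-form — so that EVERY lower-bound route feeds the N12∕s1 endpoint:
the two-sided `hlead` (by `ineq17_of_lead` + `circ_le_sum_formDk`), a one-sided `hlead⁻`, or the flat-Federbush `Ineq17` at γ₀ = 1 (n12-w4's announced slice-currency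
feeder).  Statements are those of the source theorems VERBATIM but for `(n′) (hn′) … (hlead) (hsm) (hγle)` ↦ `{γ₀} (hγ₀) … (h17) (hsm) (hγle)` (same positions);
proofs are the source proofs with the one-sided lemma `hessian_coercive_of_h17` (§0) in place of `hessian_coercive_of_hlead` and the first layer calling the
γ₀-generic root directly.

WHAT THIS FILE PROVES (no `sorry`, no definition; axioms standard).
§0 `hessian_coercive_of_h17` — the real (1.9) `(γ∕M⁵)‖u‖² ≤ ⟪u, D(rGrad g)(0)u⟫` at print's box instance from `h17` + `hsm`∕`hγle` (x₁-axial (1.8) by name).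
§1 `exists_domain_prop1Printed_lfVarOn_ofFun_regular_oneSided` (twin of `B15Prop1LocalLettersOfFun.…ofFun_regular`, calling the γ₀-generic root).
§2 `exists_domain_prop1Printed_lfVarOn_ofFun_intrinsic_oneSided`, ★ `exists_domain_prop1Printed_lfVarOn_ofFun_intrinsic_analytic_oneSided` (twins of
   `B15Prop1IntrinsicOfFun`; the private radius bookkeeping re-derived).
(The record-level layers — `Z`-sequence, guarded [15] letter, value-matched (J0ᵛ) — follow in the companion `B15Prop1OneSidedIneq17Edition`, which imports this
module; they are kept apart because the record-level import closure carries a second `DecidableEq (PBond …)` instance that the lineage neutralises there with the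
`hdec`∕`hcl` device, while the `ofFun` layers elaborate, like their sources, under `Classical.propDecidable` alone.)

HONEST SCOPE.  Binder surgery only: nothing of Bałaban asserted; (1.7) in either form, (J0ᵛ), the [15] letter remain LETTERS (the one-sided (L2) is WEAKER than
the two-sided one, so these endpoints are STRONGER theorems than their sources, proved by the same kernel argument); count-neutral; NOT a discharge of N12; nothing
continuum ∕ OS ∕ mass-gap ∕ Clay.  No `def`, no `instance`, no `sorry`.

## References
* [Balaban1989LargeFieldI] T. Bałaban, Commun. Math. Phys. 122 (1989) 175–202, (1.74) p. 192, p. 193, Prop. 1 (1.77)–(1.78) p. 194, (1.79) p. 195.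
* [Balaban1989LargeFieldII] T. Bałaban, Commun. Math. Phys. 122 (1989) 355–392, p. 357, (1.7)–(1.9) p. 358, (1.11)–(1.13) p. 359.
* [Balaban1985Variational] T. Bałaban, Commun. Math. Phys. 102 (1985) 277–309, (1) p. 277, Thm 1 (8) p. 279, Prop. 4 pp. 292–293, (181) p. 307, Prop. 9 (190) p. 309.
* [Balaban1988Convergent] T. Bałaban, Commun. Math. Phys. 119 (1988) 243–285, (2.12)–(2.14) pp. 256–257, (2.16)–(2.18) p. 257.
* [Balaban1984PropagatorsI] T. Bałaban, Commun. Math. Phys. 95 (1984) 17–40, (1.65)–(1.67) p. 29.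
-/

noncomputable section

open Set Finset Metric
open scoped BigOperators Matrix RealInnerProductSpace Real InnerProductSpace

namespace Literature.MathematicalPhysics.QuantumFieldTheory.Balaban1983to89.B15Prop1OneSidedIneq17OfFun

open B15DeterminingSets GaugeField B16Sect1Backgrounds B15Prop1Carrier B8Eq17ClassAkV1
open B15Prop1SliceTaylorCalculus B15Prop1IntrinsicAnalyticExt B15Prop1ParametricZeroBranch B15Prop1LocalLettersOfFun B15Prop1IntrinsicOfFun
open B15Prop1CarrierOnSU2BoxExt193 (thresholds_exist)
open B15Prop1LipschitzFromProp4 (dV_zero_real_of_prop4Hyp lipschitz_real_of_prop4Hyp)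
open B15Prop1AdjointOfRecord (norm_adjoint_apply_le)
open B15Prop1IntrinsicReading (prop4Hyp_congr)
open B15Prop1CriticalViaSlice (isCriticalPt_iff_of_hasDerivAt)
open B15Prop1CriticalAtBoxG0 (treeOrder_G0 tgt_G0_mem)
open B15Prop1ChartRecentering (exists_hasFDerivAt_of_differentiableAt)
open B15Prop1LocalLettersSU2Box (prop1Printed_lfVarOn_su2_box_G0_of_17_ext193_local)
open B15Prop1SliceIneq18 (ineq19_slice_of_17)
open B15Prop1AnalyticExtClause (cplxVec cplxSlice cplxSlice_apply norm_cplxSlice norm_cplxVec reSlice anExt anExt_antitone)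
open B15Prop1ChartCalculusSU2 (E3)
open T4CubeChartGnomonic (SU2)
open B15Prop1ChartSU2 (su2Chart)
open B15Prop1SliceCoordinates (GaugeSlice ιA freeBonds norm_ιA_apply_le)
open T4AxialGaugeSmallField (castSite boxPlaqs)
open T4AxialGaugeFixing (TreeOrder boxDepth)
open B7Prop1Explicit (e e_apply)
open B6BondElimination (unitVec)
open B6TreeGaugePoincare (curl)
open B16Eq18Proof (box mem_box)
open B15Extension193 (extend)
open B15ShellGauge193 (shellGauge)
open B5Bounds167Lattice (formDk ofRealCfg)
open B14.Eq213DetSet B14.Eq216Concrete B15Sect1Instances B15Eq177GaugeInvariance B15Eq177ValueInvariance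
open Literature.MathematicalPhysics.QuantumFieldTheory.BalabanImbrieJaffe1984to88.BIJ85Eq453GaugeField
open B11Prop6Scheme (Prop4Hyp)
open Classical

/-! ## §0 (1.9) at the record from the ONE-SIDED γ₀-generic (1.7) letter -/

section Coercive

variable {P : Params}

/-- The integer box `{lo ≤ x ≤ hi}` is `B16Eq18Proof.box (hi − lo + 1) lo` (as in `B15Prop1IntrinsicAnalyticAtRecord`, where it is private).
[cite: Balaban1989LargeFieldII, (1.8) p.358] -/
private theorem box_toNat_coe (lo hi : Fin P.d → ℤ) :
    (↑(box (fun i => (hi i - lo i + 1).toNat) lo) : Set (Fin P.d → ℤ)) = Set.Icc lo hi := by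
  ext x
  simp only [Finset.mem_coe, mem_box, Set.mem_Icc]
  constructor
  · intro h
    refine ⟨fun i => (h i).1, fun i => ?_⟩
    have h2 := (h i).2
    have : ((hi i - lo i + 1).toNat : ℤ) ≤ max (hi i - lo i + 1) 0 := by
      rw [Int.toNat_eq_max]
    have hm : max (hi i - lo i + 1) 0 = hi i - lo i + 1 ∨ max (hi i - lo i + 1) 0 = 0 := max_choice _ _
    rcases hm with hm | hm <;> rw [hm] at this <;> linarith [(h i).1]
  · rintro ⟨h1, h2⟩ i
    refine ⟨h1 i, ?_⟩
    have : (hi i - lo i + 1).toNat = hi i - lo i + 1 := Int.toNat_of_nonneg (by linarith [h1 i, h2 i])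
    rw [this]
    linarith [h2 i]

/-- **THE REAL (1.9) AT THE RECORD FROM THE ONE-SIDED (1.7) LETTER** — the twin of `B15Prop1IntrinsicAnalyticAtRecord.hessian_coercive_of_hlead` with the
two-sided Hessian letter `hlead` + (1.67) REPLACED by the γ₀-generic lower bound `h17 : γ₀·circ(X) − Cerr‖X‖² ≤ ⟪X, D(rGrad g)(0)X⟫` (print's (1.7) as
displayed, p. 357 «it is simple to estimate the lower bound»), `hsm`∕`hγle` in γ₀-form: at print's box instance the x₁-axial (1.8)
(`B15Prop1SliceIneq18.ineq19_slice_of_17`) gives `(γ/M⁵)‖u‖² ≤ ⟪u, D(rGrad g)(0) u⟫`. [cite: Balaban1989LargeFieldII, p.357, (1.7)–(1.9) p.358] -/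
theorem hessian_coercive_of_h17 (hd3 : 3 ≤ P.d) (h0 : 0 < P.d) {k : ℕ} {Λ : Set (Site P 0)} {T : Finset (PBond P k)}
    {lo hi : Fin P.d → ℤ} (hbox : pts k Λ = (castSite '' Set.Icc lo hi : Set (Site P k)))
    (hTG0 : T = (box (fun κ => (hi κ - lo κ + 1).toNat) lo).image fun x => (⟨castSite (x - unitVec ⟨0, h0⟩), ⟨0, h0⟩⟩ : PBond P k))
    (hN5 : ∀ κ, ((hi κ - lo κ + 1).toNat : ℤ) + 5 < P.sitesPerDir k) {K : ℕ} (hK1 : 1 ≤ K) (hKn : ∀ κ, (hi κ - lo κ + 1).toNat ≤ K)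
    {γ M Cerr γ₀ : ℝ} (hγ₀ : 0 ≤ γ₀) (g : GaugeSlice (pts k Λ) T E3 → ℝ)
    (h17 : ∀ X : GaugeSlice (pts k Λ) T E3,
      γ₀ * (∑ z ∈ box (fun κ => (hi κ - lo κ + 1).toNat + 3) (fun κ => lo κ - 2), ∑ μ : Fin P.d, ∑ a : Fin 3,
          curl (fun b => ιA (pts k Λ) T X (⟨castSite b.1, b.2⟩ : PBond P k) a) z ⟨0, h0⟩ μ ^ 2) -
        Cerr * ‖X‖ ^ 2 ≤ ⟪X, (fderiv ℝ (rGrad (pts k Λ) T g) 0) X⟫)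
    (hsm : Cerr ≤ γ₀ / (2 * (3 * (K : ℝ) ^ 2 + 2 * (K : ℝ) ^ 4)))
    (hγle : γ / M ^ 5 ≤ γ₀ / (2 * (3 * (K : ℝ) ^ 2 + 2 * (K : ℝ) ^ 4))) (u : GaugeSlice (pts k Λ) T E3) :
    γ / M ^ 5 * ‖u‖ ^ 2 ≤ ⟪u, fderiv ℝ (rGrad (pts k Λ) T g) 0 u⟫_ℝ := by
  have h1 : 1 < P.d := by omega
  have hS : pts k Λ = castSite '' (↑(box (fun κ => (hi κ - lo κ + 1).toNat) lo) : Set (Fin P.d → ℤ)) := by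
    rw [hbox, box_toNat_coe]
  have h17' : ∀ X : GaugeSlice (pts k Λ) T E3,
      γ₀ * (∑ z ∈ box (fun κ => (hi κ - lo κ + 1).toNat + 3) (fun κ => lo κ - 2), ∑ μ : Fin P.d, ∑ a : Fin 3,
            curl (fun b => ιA (pts k Λ) T X (⟨castSite b.1, b.2⟩ : PBond P k) a) z ⟨0, h0⟩ μ ^ 2) -
        Cerr * ‖X‖ ^ 2 ≤
      inner ℝ ((LinearMap.id : _ →ₗ[ℝ] _) X)
        (((fderiv ℝ (rGrad (pts k Λ) T g) 0).toLinearMap) ((LinearMap.id : _ →ₗ[ℝ] _) X)) := fun X => by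
    simpa only [LinearMap.id_coe, id_eq, ContinuousLinearMap.coe_coe] using h17 X
  have h19 := ineq19_slice_of_17 h0 h1 hN5 hK1 (hKn ⟨0, h0⟩) (hKn ⟨1, h1⟩) hS hTG0 LinearMap.id
    ((fderiv ℝ (rGrad (pts k Λ) T g) 0).toLinearMap) hγ₀ h17' hsm u
  simp only [LinearMap.id_coe, id_eq, ContinuousLinearMap.coe_coe] at h19
  exact (mul_le_mul_of_nonneg_right hγle (sq_nonneg _)).trans h19

end Coercive


/-! ## §1 The local `ofFun` layer with the one-sided letter (twin of `B15Prop1LocalLettersOfFun`) -/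

section OfFun

variable {P : Params}

/-- **ONE-SIDED (γ₀-generic (1.7)) edition.** ★★ **THE LOCAL ENDPOINT OF PROPOSITION 1 [IV] OVER A BARE FUNCTION FAMILY** — `B15Prop1LocalLettersRecord.exists_domain_prop1Printed_lfVarOn_std_su2_box_regular`
with print's function `A ∘ U_{k,Z}` replaced by an arbitrary `f i : GaugeField P (k i) SU2 → ℝ` and the (181) letter `Cov181` replaced by p. 194's
sentence *«The function is invariant with respect to the group of all gauge transformations defined on Λ»* as the hypothesis `hf`.  From the letters
`h17` ((1.7) for the leading form, abstract `H`, `Δ₁`), `hH` ((190)), `hW`∕`hWdV` (Proposition 4 [15]), `hA` ((1.11)–(1.12), first variation),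
`hJ` (p. 359, the current), `hG` (differentiability in print's coordinates), `hAn` (the carried clause), all at `eR`-regular boundary data and on the
ball `‖B′‖ ≤ r ≤ 1/2`, plus the structural box∕margin∕constant hypotheses: `∃ a₁ > 0, B15.Prop1Printed (lfVarOn su2Chart fun i => ⟨⟨k i, Z i, Λ i, M i,
f i, An i⟩, domReg (Z i) (k i) (a₁ i)⟩)`.  Layers 5–10 of the local chain BY NAME. [cite: Balaban1989LargeFieldI, Prop. 1 (1.77)–(1.78) p.194, p.193;
Balaban1989LargeFieldII, pp.357–359, (1.12); Balaban1985Variational, Prop. 4 pp.292–293, (190) p.308] -/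
theorem exists_domain_prop1Printed_lfVarOn_ofFun_regular_oneSided (hd3 : 3 ≤ P.d) (h0 : 0 < P.d) {ι : Type}
    (Z Λ : ι → Set (Site P 0)) (k : ι → ℕ) (M : ι → ℝ)
    (f : ∀ i, GaugeField P (k i) SU2 → ℝ) (An : ∀ i, ℝ → GaugeField P (k i) SU2 → Prop)
    -- p. 194 «The function is invariant with respect to the group of all gauge transformations defined on Λ» (asked for all of `T^{(k)}`'s)
    (hf : ∀ i (u : GaugeTransf P (k i) SU2) (V : GaugeField P (k i) SU2), f i (gaugeAct u V) = f i V)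
    (eR : ι → ℝ) (heR : ∀ i, 0 < eR i)
    (T : ∀ i, Finset (PBond P (k i)))
    {F : ι → Type*} [∀ i, NormedAddCommGroup (F i)] [∀ i, InnerProductSpace ℝ (F i)] [∀ i, FiniteDimensional ℝ (F i)]
    (H : ∀ i, GaugeField P (k i) SU2 →
      (GaugeSlice (pts (k i) (Λ i)) (T i) (EuclideanSpace ℝ (Fin 3)) →ₗ[ℝ] F i))
    (Δ₁ : ∀ i, GaugeField P (k i) SU2 → (F i →ₗ[ℝ] F i)) (dV : ∀ i, GaugeField P (k i) SU2 → F i → F i)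
    {Fc : ι → Type*} [∀ i, NormedAddCommGroup (Fc i)] [∀ i, NormedSpace ℂ (Fc i)] (emb : ∀ i, F i → Fc i)
    (hemb : ∀ i (u v : F i), ‖emb i u - emb i v‖ = ‖u - v‖) (hemb0 : ∀ i, emb i 0 = 0)
    (W : ∀ i, GaugeField P (k i) SU2 → Fc i → Fc i) {C₄ a₃ a : ι → ℝ} (hC₄ : ∀ i, 0 ≤ C₄ i) (ha : ∀ i, 0 < a i)
    (hW : ∀ i Vk, PlaqSmallOn (plaqsInside (pts (k i) (Z i ∩ (Λ i)ᶜ))) (eR i) Vk → Prop4Hyp (W i Vk) (C₄ i) (a₃ i))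
    (hWdV : ∀ i Vk (u : F i), W i Vk (emb i u) = emb i (dV i Vk u))
    (J : ∀ i, GaugeField P (k i) SU2 → F i)
    (lo hi : ι → Fin P.d → ℤ) (n : ι → ℕ) (hn : ∀ i κ, hi i κ ≤ lo i κ + n i) (hN : ∀ i, n i + 2 < P.sitesPerDir (k i))
    (hbox : ∀ i, pts (k i) (Λ i) = (castSite '' Set.Icc (lo i) (hi i) : Set (Site P (k i))))
    (hZ : ∀ i, (boxPlaqs (lo i - 1) (hi i + 1) : Set (Plaq P (k i))) ⊆ plaqsInside (pts (k i) (Z i)))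
    -- (`G₀`: the image is taken with the classical `DecidableEq` instance, as in p518722's statement — any other instance gives the
    -- same `Finset`, the instances forming a subsingleton)
    (hTG0 : ∀ i, T i = @Finset.image (Fin P.d → ℤ) (PBond P (k i)) (fun a b => Classical.propDecidable (a = b))
      (fun x => (⟨castSite (x - unitVec ⟨0, h0⟩), ⟨0, h0⟩⟩ : PBond P (k i))) (box (fun κ => (hi i κ - lo i κ + 1).toNat) (lo i)))
    (hN5 : ∀ i κ, ((hi i κ - lo i κ + 1).toNat : ℤ) + 5 < P.sitesPerDir (k i))
    (K : ι → ℕ) (hK1 : ∀ i, 1 ≤ K i) (hKn : ∀ i κ, (hi i κ - lo i κ + 1).toNat ≤ K i)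
    (ext : ∀ i, GaugeField P (k i) SU2 → GaugeField P (k i) SU2)
    (hext : ∀ i Vk, ext i Vk = extend (pts (k i) (Λ i)) (shellGauge Vk (lo i) (hi i)) Vk)
    (hlohi : ∀ i, lo i ≤ hi i)
    {γ h₁ cJ bx : ℝ} (hγ : 0 < γ) (hh₁ : 0 ≤ h₁) (hcJ : 0 ≤ cJ) (hbx : 0 ≤ bx)
    (hbxM : ∀ i, 12 * (P.d : ℝ) * ((n i : ℝ) + 2) ^ 2 ≤ bx * (M i) ^ 2)
    {ρ r eA Cerr : ι → ℝ} (hr : ∀ i, 0 < r i) (heA : ∀ i, 0 < eA i) (hM : ∀ i, 1 ≤ (M i))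
    {γ₀ : ℝ} (hγ₀ : 0 ≤ γ₀)
    (h17 : ∀ i Vk, PlaqSmallOn (plaqsInside (pts (k i) (Z i ∩ (Λ i)ᶜ))) (eR i) Vk → ∀ X : GaugeSlice (pts (k i) (Λ i)) (T i) (EuclideanSpace ℝ (Fin 3)),
      γ₀ * (∑ z ∈ box (fun κ => (hi i κ - lo i κ + 1).toNat + 3) (fun κ => lo i κ - 2), ∑ μ : Fin P.d, ∑ a : Fin 3,
          curl (fun b => ιA (pts (k i) (Λ i)) (T i) X (⟨castSite b.1, b.2⟩ : PBond P (k i)) a) z ⟨0, h0⟩ μ ^ 2) -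
        Cerr i * ‖X‖ ^ 2 ≤ ⟪H i Vk X, Δ₁ i Vk (H i Vk X)⟫)
    (hsm : ∀ i, Cerr i ≤ γ₀ / (2 * (3 * (K i : ℝ) ^ 2 + 2 * (K i : ℝ) ^ 4)))
    (hγle : ∀ i, γ / (M i) ^ 5 ≤ γ₀ / (2 * (3 * (K i : ℝ) ^ 2 + 2 * (K i : ℝ) ^ 4)))
    (hH : ∀ i Vk, PlaqSmallOn (plaqsInside (pts (k i) (Z i ∩ (Λ i)ᶜ))) (eR i) Vk → ∀ x, ‖H i Vk x‖ ≤ h₁ * ‖x‖)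
    (hρ : ∀ i, h₁ * r i ≤ ρ i) (ha₃ : ∀ i, 2 * (ρ i + a i) ≤ a₃ i)
    (hsmall : ∀ i, (M i) ^ 5 / γ * h₁ * (4 * C₄ i * (ρ i + a i)) * h₁ ≤ 1 / 2)
    (hA : ∀ i Vk, PlaqSmallOn (plaqsInside (pts (k i) (Z i ∩ (Λ i)ᶜ))) (eR i) Vk →
      ∀ X δ : GaugeSlice (pts (k i) (Λ i)) (T i) (EuclideanSpace ℝ (Fin 3)), ‖X‖ ≤ r i →
      HasDerivAt (fun s : ℝ => f i (expMul su2Chart (ιA (pts (k i) (Λ i)) (T i) (X + s • δ)) (ext i Vk)))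
      (⟪H i Vk δ, J i Vk⟫ + ⟪H i Vk δ, Δ₁ i Vk (H i Vk X)⟫ + ⟪H i Vk δ, dV i Vk (H i Vk X)⟫) 0)
    (hJ : ∀ i ε Vk, 0 < ε → PlaqSmallOn (plaqsInside (pts (k i) (Z i ∩ (Λ i)ᶜ))) ε Vk → ‖J i Vk‖ ≤ cJ * ε)
    (hG : ∀ i Vk, PlaqSmallOn (plaqsInside (pts (k i) (Z i ∩ (Λ i)ᶜ))) (eR i) Vk →
      ∀ B : GaugeSlice (pts (k i) (Λ i)) (T i) (EuclideanSpace ℝ (Fin 3)), ‖B‖ ≤ r i →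
      DifferentiableAt ℝ (fun B' : VecField P (k i) (EuclideanSpace ℝ (Fin 3)) => f i (expMul su2Chart B' (ext i Vk)))
        (ιA (pts (k i) (Λ i)) (T i) B))
    (hr2 : ∀ i, r i ≤ 1 / 2)
    (hAn : ∀ i ε Vk, 0 < ε → ε ≤ eA i → PlaqSmallOn (plaqsInside (pts (k i) (Z i ∩ (Λ i)ᶜ))) ε Vk → An i ε Vk)
    : ∃ a₁ : ι → ℝ, (∀ i, 0 < a₁ i) ∧
      B15.Prop1Printed (lfVarOn su2Chart fun i =>
        (⟨⟨k i, Z i, Λ i, M i, f i, An i⟩, domReg (Z i) (k i) (a₁ i)⟩ : InstOn P SU2)) := by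
  -- the classical `DecidableEq` instance on bonds, as in the statement (`hTG0`, the slices); local instances take precedence
  letI : ∀ i, DecidableEq (PBond P (k i)) := fun i a b => Classical.propDecidable (a = b)
  -- print's regularity predicate at the scale `eR` and its bridge (monotonicity of `<`)
  set Rg : ∀ i, GaugeField P (k i) SU2 → Prop :=
    fun i Vk => PlaqSmallOn (plaqsInside (pts (k i) (Z i ∩ (Λ i)ᶜ))) (eR i) Vk with hRg_def
  have hRg : ∀ i ε Vk, 0 < ε → ε ≤ eR i → PlaqSmallOn (plaqsInside (pts (k i) (Z i ∩ (Λ i)ᶜ))) ε Vk → Rg i Vk :=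
    fun _ _ _ _ hle hV p hp => (hV p hp).trans_le hle
  -- the domain constant `a₁` and the thresholds, chosen (p. 194 «e.g., |∂V_k − 1| < a₁ on Z», p. 359 «for ε sufficiently small»)
  have hex : ∀ i, ∃ δc a₁ eD : ℝ, 0 < δc ∧ 0 < a₁ ∧ 0 < eD ∧
      Real.sqrt (freeBonds (pts (k i) (Λ i)) (T i)).card * (π / 2 * δc) ≤ r i ∧
      (∀ ε : ℝ, 0 < ε → ε ≤ eD → ((n i : ℝ) + 2) * ((n i : ℝ) + P.d) * (a₁ + (bx * (M i) ^ 2 * ε + ε)) < δc) ∧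
      ∀ ε : ℝ, 0 < ε → ε ≤ eD → (4 * 1 * (2 * (M i) ^ 5 * h₁ * cJ / γ) + bx * (M i) ^ 2) * ε < a₁ :=
    fun i => thresholds_exist _ (hr i) hγ (hM i) hh₁ hcJ hbx (n i) P.d
  choose δc a₁ eD hδc ha₁ heD hN' hδ he1 using hex
  have hρ0 : ∀ i, 0 ≤ ρ i := fun i => (mul_nonneg hh₁ (hr i).le).trans (hρ i)
  refine ⟨a₁, ha₁, ?_⟩
  -- layers 5–10 by name: (1.67) + print's box instance + Prop. 4 → Lipschitz + `H* := H†` + (c3) from `hG`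
  refine prop1Printed_lfVarOn_su2_box_G0_of_17_ext193_local hd3 h0
    (fun i => (⟨⟨k i, Z i, Λ i, M i, f i, An i⟩, domReg (Z i) (k i) (a₁ i)⟩ : InstOn P SU2)) Rg T H
    (fun i Vk => LinearMap.adjoint (H i Vk)) (fun i Vk x y => (LinearMap.adjoint_inner_right (H i Vk) x y).symm) Δ₁ dV J
    lo hi n hn hN hbox hZ hTG0 hN5 K hK1 hKn ext hext hlohi hγ hγ₀ hh₁ hh₁ hcJ hbx hbxM
    (ℓ := fun i => 4 * C₄ i * (ρ i + a i)) (fun i => by have := hC₄ i; have := ha i; have := hρ0 i; positivity)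
    hr heA heD heR hRg hδc (fun i => (ha₁ i).le) hM h17 hsm hγle hH
    (fun i Vk hR z => norm_adjoint_apply_le (H i Vk) hh₁ (hH i Vk hR) z)
    (fun i Vk hR => dV_zero_real_of_prop4Hyp (emb i) (hemb i) (hemb0 i) (hW i Vk hR) (by linarith [ha₃ i, ha i, hρ0 i]) (hWdV i Vk))
    (fun i Vk hR => lipschitz_real_of_prop4Hyp (emb i) (hemb i) (hemb0 i) (hW i Vk hR) (hC₄ i) (ha i) (hρ0 i) (ha₃ i) (hWdV i Vk))
    hρ hsmall (fun i Vk hR X δ hX => ?_) hJ (fun i Vk hR B hB => ?_) (fun i u V _ => hf i u V) hAn (fun i => rfl) hN' hδ he1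
  · -- (m5): the first-variation letter in the `H†` form
    simpa only [LinearMap.adjoint_inner_right] using hA i Vk hR X δ hX
  · -- (c3): criticality at the chart point `exp(i·ιA B)·Ṽ_k` ⇔ (1.12), from `hG` through the slice criterion over the x₁-axial `G₀`
    have hNw : ∀ κ, hi i κ - lo i κ + 1 < (P.sitesPerDir (k i) : ℤ) := fun κ => by
      have h5 := hN5 i κ
      have : hi i κ - lo i κ + 1 ≤ ((hi i κ - lo i κ + 1).toNat : ℤ) := Int.self_le_toNat _
      linarith
    have hT : TreeOrder (T i) PBond.tgt (boxDepth (lo i - e ⟨0, h0⟩) (hi i)) := by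
      rw [hTG0 i]; exact treeOrder_G0 h0 hNw
    have hv : ∀ b ∈ T i, b.tgt ∈ pts (k i) (Λ i) := fun b hb => by
      rw [hbox i]; rw [hTG0 i] at hb; exact tgt_G0_mem h0 (lo i) (hi i) b hb
    have hX : ∀ b, ‖ιA (pts (k i) (Λ i)) (T i) B b‖ < π := fun b =>
      (norm_ιA_apply_le B b).trans_lt (hB.trans_lt ((hr2 i).trans_lt (by linarith [Real.pi_gt_three])))
    obtain ⟨D, hD⟩ := exists_hasFDerivAt_of_differentiableAt _ (ext i Vk) hX (hG i Vk hR B hB)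
    have key := isCriticalPt_iff_of_hasDerivAt hT hv (fun u hu V => hf i u V) (ext i Vk) (hB.trans (hr2 i)) hD
      (fun δ => hA i Vk hR B δ hB)
    simpa only [LinearMap.adjoint_inner_right] using key

/-! ## §2 The intrinsic `ofFun` layers with the one-sided letter (twins of `B15Prop1IntrinsicOfFun`) -/

/-- The radius bookkeeping of the intrinsic reading (as in `B15Prop1IntrinsicReading`, where it is private): with `r = min (1/2) (min (R/8)
(γR³/(1024·M⁵·(𝓐+1))))`, `0 < r ≤ 1/2`, `4r ≤ R/2`, `(M⁵/γ)·(4·(64𝓐/R³)·2r) ≤ 1/2`. [cite: Balaban1989LargeFieldII, (1.13) p.359] -/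
private theorem radius_bookkeeping {R 𝓐 γ M : ℝ} (hR : 0 < R) (h𝓐 : 0 ≤ 𝓐) (hγ : 0 < γ) (hM : 1 ≤ M) :
    let r := min (1 / 2) (min (R / 8) (γ * R ^ 3 / (1024 * M ^ 5 * (𝓐 + 1))))
    0 < r ∧ r ≤ 1 / 2 ∧ 2 * (r + r) ≤ R / 2 ∧ M ^ 5 / γ * 1 * (4 * (64 * 𝓐 / R ^ 3) * (r + r)) * 1 ≤ 1 / 2 := by
  intro r
  have hM0 : 0 < M := by linarith
  have hM5 : 0 < M ^ 5 := by positivity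
  have hden : 0 < 1024 * M ^ 5 * (𝓐 + 1) := by positivity
  have hr0 : 0 < r := lt_min (by norm_num) (lt_min (by linarith) (div_pos (by positivity) hden))
  have hr2 : r ≤ 1 / 2 := min_le_left _ _
  have hrR : r ≤ R / 8 := (min_le_right _ _).trans (min_le_left _ _)
  have hr𝓐 : r ≤ γ * R ^ 3 / (1024 * M ^ 5 * (𝓐 + 1)) := (min_le_right _ _).trans (min_le_right _ _)
  refine ⟨hr0, hr2, by linarith, ?_⟩
  have hR3 : 0 < R ^ 3 := by positivity
  have h1 : r * (1024 * M ^ 5 * (𝓐 + 1)) ≤ γ * R ^ 3 := (le_div_iff₀ hden).1 hr𝓐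
  have e : M ^ 5 / γ * 1 * (4 * (64 * 𝓐 / R ^ 3) * (r + r)) * 1 = (512 * M ^ 5 * 𝓐 * r) / (γ * R ^ 3) := by
    field_simp
    ring
  rw [e, div_le_iff₀ (by positivity)]
  nlinarith [mul_nonneg h𝓐 hr0.le, mul_nonneg (mul_nonneg hM5.le h𝓐) hr0.le]

/-- **ONE-SIDED (γ₀-generic (1.7)) edition.** ★★ **PROPOSITION 1 [IV] IN THE INTRINSIC READING OF (1.11)–(1.12), OVER A BARE FUNCTION FAMILY** — the twin of
`B15Prop1IntrinsicReading.exists_domain_prop1Printed_lfVarOn_std_su2_box_intrinsic'` with `A ∘ U_{k,Z}` replaced by `f i` and (181) by the value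
invariance `hf`.  `F i :=` the gauge-fixed coordinates, `H := id`, `J`, `Δ₁`, `(δ/δA)V` := the Taylor data at `0` of `g = sliceFn … (f i) (ext i V_k)`
(*«We expand the function with respect to B′»*), `W :=` the complex Taylor remainder of the gradient of its holomorphic extension.  Letters: (L1) `hGc`
(holomorphic extension to `‖B′‖ < R` in `𝔤ᶜ`, bounded by `𝓐`, at `eR`-regular data), (L2) `h17` + `hsm`∕`hγle`, (L3) `hJ` (at `ε ≤ eR`); `hf`; `hAn`;
structural hypotheses. [cite: Balaban1989LargeFieldI, Prop. 1 (1.77)–(1.78) p.194, p.193; Balaban1989LargeFieldII, (1.7)–(1.9) p.358, (1.11)–(1.13)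
p.359; Balaban1985Variational, Prop. 4 pp.292–293] -/
theorem exists_domain_prop1Printed_lfVarOn_ofFun_intrinsic_oneSided (hd3 : 3 ≤ P.d) (h0 : 0 < P.d) {ι : Type}
    (Z Λ : ι → Set (Site P 0)) (k : ι → ℕ) (M : ι → ℝ)
    (f : ∀ i, GaugeField P (k i) SU2 → ℝ) (An : ∀ i, ℝ → GaugeField P (k i) SU2 → Prop)
    (hf : ∀ i (u : GaugeTransf P (k i) SU2) (V : GaugeField P (k i) SU2), f i (gaugeAct u V) = f i V)
    (eR : ι → ℝ) (heR : ∀ i, 0 < eR i)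
    (T : ∀ i, Finset (PBond P (k i)))
    (lo hi : ι → Fin P.d → ℤ) (n : ι → ℕ) (hn : ∀ i κ, hi i κ ≤ lo i κ + n i) (hN : ∀ i, n i + 2 < P.sitesPerDir (k i))
    (hbox : ∀ i, pts (k i) (Λ i) = (castSite '' Set.Icc (lo i) (hi i) : Set (Site P (k i))))
    (hZ : ∀ i, (boxPlaqs (lo i - 1) (hi i + 1) : Set (Plaq P (k i))) ⊆ plaqsInside (pts (k i) (Z i)))
    -- (`G₀`: the image is taken with the classical `DecidableEq` instance, as in p518722's statement — any other instance gives the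
    -- same `Finset`, the instances forming a subsingleton)
    (hTG0 : ∀ i, T i = @Finset.image (Fin P.d → ℤ) (PBond P (k i)) (fun a b => Classical.propDecidable (a = b))
      (fun x => (⟨castSite (x - unitVec ⟨0, h0⟩), ⟨0, h0⟩⟩ : PBond P (k i))) (box (fun κ => (hi i κ - lo i κ + 1).toNat) (lo i)))
    (hN5 : ∀ i κ, ((hi i κ - lo i κ + 1).toNat : ℤ) + 5 < P.sitesPerDir (k i))
    (K : ι → ℕ) (hK1 : ∀ i, 1 ≤ K i) (hKn : ∀ i κ, (hi i κ - lo i κ + 1).toNat ≤ K i)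
    (ext : ∀ i, GaugeField P (k i) SU2 → GaugeField P (k i) SU2)
    (hext : ∀ i Vk, ext i Vk = extend (pts (k i) (Λ i)) (shellGauge Vk (lo i) (hi i)) Vk)
    (hlohi : ∀ i, lo i ≤ hi i)
    {γ cJ bx : ℝ} (hγ : 0 < γ) (hcJ : 0 ≤ cJ) (hbx : 0 ≤ bx)
    (hbxM : ∀ i, 12 * (P.d : ℝ) * ((n i : ℝ) + 2) ^ 2 ≤ bx * (M i) ^ 2)
    {eA Cerr R 𝓐 : ι → ℝ} (heA : ∀ i, 0 < eA i) (hM : ∀ i, 1 ≤ (M i)) (hR : ∀ i, 0 < R i) (h𝓐 : ∀ i, 0 ≤ 𝓐 i)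
    {γ₀ : ℝ} (hγ₀ : 0 ≤ γ₀)
    -- (L1) [15] Thm 1 ∕ [LF-II] p.359 «valid for 𝔤ᶜ-valued fields»: the holomorphic extension of the function to complex bond fields
    (hGc : ∀ i Vk, PlaqSmallOn (plaqsInside (pts (k i) (Z i ∩ (Λ i)ᶜ))) (eR i) Vk →
      ∃ G : VecField P (k i) (EuclideanSpace ℂ (Fin 3)) → ℂ, DifferentiableOn ℂ G (ball 0 (R i)) ∧
        (∀ Y ∈ ball (0 : VecField P (k i) (EuclideanSpace ℂ (Fin 3))) (R i), ‖G Y‖ ≤ 𝓐 i) ∧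
        ∀ B' : VecField P (k i) E3, ‖B'‖ < R i → G (cplxVec B') = ((f i (expMul su2Chart B' (ext i Vk)) : ℝ) : ℂ))
    -- (L2) (1.7)–(1.9) p.358 for the Hessian of the slice function at `0`
    (h17 : ∀ i Vk, PlaqSmallOn (plaqsInside (pts (k i) (Z i ∩ (Λ i)ᶜ))) (eR i) Vk → ∀ X : GaugeSlice (pts (k i) (Λ i)) (T i) E3,
      γ₀ * (∑ z ∈ box (fun κ => (hi i κ - lo i κ + 1).toNat + 3) (fun κ => lo i κ - 2), ∑ μ : Fin P.d, ∑ a : Fin 3,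
          curl (fun b => ιA (pts (k i) (Λ i)) (T i) X (⟨castSite b.1, b.2⟩ : PBond P (k i)) a) z ⟨0, h0⟩ μ ^ 2) -
        Cerr i * ‖X‖ ^ 2 ≤ ⟪X, (fderiv ℝ (rGrad (pts (k i) (Λ i)) (T i) (sliceFn (pts (k i) (Λ i)) (T i) (f i) (ext i Vk))) 0) X⟫)
    (hsm : ∀ i, Cerr i ≤ γ₀ / (2 * (3 * (K i : ℝ) ^ 2 + 2 * (K i : ℝ) ^ 4)))
    (hγle : ∀ i, γ / (M i) ^ 5 ≤ γ₀ / (2 * (3 * (K i : ℝ) ^ 2 + 2 * (K i : ℝ) ^ 4)))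
    -- (L3) p.359: the gradient at `0` is small at regular data
    (hJ : ∀ i ε Vk, 0 < ε → ε ≤ eR i → PlaqSmallOn (plaqsInside (pts (k i) (Z i ∩ (Λ i)ᶜ))) ε Vk →
      ‖rGrad (pts (k i) (Λ i)) (T i) (sliceFn (pts (k i) (Λ i)) (T i) (f i) (ext i Vk)) 0‖ ≤ cJ * ε)
    (hAn : ∀ i ε Vk, 0 < ε → ε ≤ eA i → PlaqSmallOn (plaqsInside (pts (k i) (Z i ∩ (Λ i)ᶜ))) ε Vk → An i ε Vk)
    : ∃ a₁ : ι → ℝ, (∀ i, 0 < a₁ i) ∧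
      B15.Prop1Printed (lfVarOn su2Chart fun i =>
        (⟨⟨k i, Z i, Λ i, M i, f i, An i⟩, domReg (Z i) (k i) (a₁ i)⟩ : InstOn P SU2)) := by
  -- the slice functions, the regularity predicate, the chosen holomorphic extensions (junk `0` off regular data)
  set gs : ∀ i, GaugeField P (k i) SU2 → GaugeSlice (pts (k i) (Λ i)) (T i) E3 → ℝ :=
    fun i Vk => sliceFn (pts (k i) (Λ i)) (T i) (f i) (ext i Vk) with hgs
  set Rg : ∀ i, GaugeField P (k i) SU2 → Prop := fun i Vk => PlaqSmallOn (plaqsInside (pts (k i) (Z i ∩ (Λ i)ᶜ))) (eR i) Vk with hRg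
  set Gsel : ∀ i, GaugeField P (k i) SU2 → VecField P (k i) (EuclideanSpace ℂ (Fin 3)) → ℂ :=
    fun i Vk => if h : Rg i Vk then Classical.choose (hGc i Vk h) else 0 with hGsel
  have hGsel_spec : ∀ i Vk, Rg i Vk → DifferentiableOn ℂ (Gsel i Vk) (ball 0 (R i)) ∧
      (∀ Y ∈ ball (0 : VecField P (k i) (EuclideanSpace ℂ (Fin 3))) (R i), ‖Gsel i Vk Y‖ ≤ 𝓐 i) ∧
      ∀ B' : VecField P (k i) E3, ‖B'‖ < R i → Gsel i Vk (cplxVec B') = ((f i (expMul su2Chart B' (ext i Vk)) : ℝ) : ℂ) := by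
    intro i Vk h
    have e : Gsel i Vk = Classical.choose (hGc i Vk h) := by simp only [hGsel, dif_pos h]
    rw [e]
    exact Classical.choose_spec (hGc i Vk h)
  -- the complex slice functions and the true remainder
  set Gs : ∀ i, GaugeField P (k i) SU2 → GaugeSlice (pts (k i) (Λ i)) (T i) (EuclideanSpace ℂ (Fin 3)) → ℂ :=
    fun i Vk Y => Gsel i Vk (ιAc (pts (k i) (Λ i)) (T i) Y) with hGs
  set dV : ∀ i, GaugeField P (k i) SU2 → GaugeSlice (pts (k i) (Λ i)) (T i) E3 → GaugeSlice (pts (k i) (Λ i)) (T i) E3 :=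
    fun i Vk X => rGrad _ _ (gs i Vk) X - rGrad _ _ (gs i Vk) 0 - fderiv ℝ (rGrad _ _ (gs i Vk)) 0 X with hdV
  set Wt : ∀ i, GaugeField P (k i) SU2 → GaugeSlice (pts (k i) (Λ i)) (T i) (EuclideanSpace ℂ (Fin 3)) →
      GaugeSlice (pts (k i) (Λ i)) (T i) (EuclideanSpace ℂ (Fin 3)) :=
    fun i Vk Y => cGrad _ _ (Gs i Vk) Y - cGrad _ _ (Gs i Vk) 0 - fderiv ℂ (cGrad _ _ (Gs i Vk)) 0 Y with hWt
  set W : ∀ i, GaugeField P (k i) SU2 → GaugeSlice (pts (k i) (Λ i)) (T i) (EuclideanSpace ℂ (Fin 3)) →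
      GaugeSlice (pts (k i) (Λ i)) (T i) (EuclideanSpace ℂ (Fin 3)) :=
    fun i Vk Y => if ‖Y‖ < R i / 2 ∧ Rg i Vk then Wt i Vk Y else cplxSlice _ _ (dV i Vk (reSlice _ _ Y)) with hW
  -- the package at regular data
  have pkg : ∀ i Vk, Rg i Vk →
      (∀ B : GaugeSlice (pts (k i) (Λ i)) (T i) E3, ‖B‖ < R i →
        DifferentiableAt ℝ (fun B' : VecField P (k i) E3 => f i (expMul su2Chart B' (ext i Vk)))
          (ιA (pts (k i) (Λ i)) (T i) B)) ∧
      (∀ X δ : GaugeSlice (pts (k i) (Λ i)) (T i) E3, ‖X‖ < R i →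
        HasDerivAt (fun s : ℝ => gs i Vk (X + s • δ))
          (⟪δ, rGrad _ _ (gs i Vk) 0⟫_ℝ + ⟪δ, (fderiv ℝ (rGrad _ _ (gs i Vk)) 0) X⟫_ℝ + ⟪δ, dV i Vk X⟫_ℝ) 0) ∧
      Prop4Hyp (Wt i Vk) (64 * 𝓐 i / R i ^ 3) (R i / 2) ∧
      (∀ u : GaugeSlice (pts (k i) (Λ i)) (T i) E3, ‖u‖ < R i → Wt i Vk (cplxSlice _ _ u) = cplxSlice _ _ (dV i Vk u)) := by
    intro i Vk h
    obtain ⟨hd, hb, hr⟩ := hGsel_spec i Vk h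
    exact slice_package_of_holomorphic (pts (k i) (Λ i)) (T i) (f i) (ext i Vk) (hR i) (Gsel i Vk) hd hb hr
  -- the radii
  set r : ι → ℝ := fun i => min (1 / 2) (min (R i / 8) (γ * R i ^ 3 / (1024 * M i ^ 5 * (𝓐 i + 1)))) with hr
  have hrb : ∀ i, 0 < r i ∧ r i ≤ 1 / 2 ∧ 2 * (r i + r i) ≤ R i / 2 ∧
      M i ^ 5 / γ * 1 * (4 * (64 * 𝓐 i / R i ^ 3) * (r i + r i)) * 1 ≤ 1 / 2 :=
    fun i => radius_bookkeeping (hR i) (h𝓐 i) hγ (hM i)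
  have hrR : ∀ i, r i < R i := fun i => by
    have := (hrb i).2.2.1
    linarith [hR i]
  refine exists_domain_prop1Printed_lfVarOn_ofFun_regular_oneSided hd3 h0 Z Λ k M f An hf eR heR T
    (F := fun i => GaugeSlice (pts (k i) (Λ i)) (T i) E3)
    (fun i _ => LinearMap.id) (fun i Vk => (fderiv ℝ (rGrad _ _ (gs i Vk)) 0).toLinearMap) dV
    (Fc := fun i => GaugeSlice (pts (k i) (Λ i)) (T i) (EuclideanSpace ℂ (Fin 3)))
    (fun i => cplxSlice (pts (k i) (Λ i)) (T i)) (fun i u v => by rw [← map_sub, norm_cplxSlice]) (fun i => map_zero _)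
    W (C₄ := fun i => 64 * 𝓐 i / R i ^ 3) (a₃ := fun i => R i / 2) (a := r)
    (fun i => div_nonneg (mul_nonneg (by norm_num) (h𝓐 i)) (pow_nonneg (hR i).le 3)) (fun i => (hrb i).1)
    (fun i Vk hV => ?hW) (fun i Vk u => ?hWdV)
    (fun i Vk => if Rg i Vk then rGrad _ _ (gs i Vk) 0 else 0)
    lo hi n hn hN hbox hZ hTG0 hN5 K hK1 hKn ext hext hlohi hγ zero_le_one hcJ hbx hbxM (ρ := r) (r := r)
    (fun i => (hrb i).1) heA hM hγ₀
    (fun i Vk hV X => by simpa only [LinearMap.id_coe, id_eq, ContinuousLinearMap.coe_coe] using h17 i Vk hV X)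
    hsm hγle (fun i Vk _ x => by simp) (fun i => le_of_eq (one_mul _)) (fun i => (hrb i).2.2.1) (fun i => (hrb i).2.2.2)
    (fun i Vk hV X δ hX => ?hA) (fun i ε Vk hε hV => ?hJ) (fun i Vk hV B hB => ((pkg i Vk hV).1 B (hB.trans_lt (hrR i))))
    (fun i => (hrb i).2.1) hAn
  case hW =>
    -- on the ball `‖Y‖ < R/2` at regular data `W = Wt`
    refine prop4Hyp_congr (pkg i Vk hV).2.2.1 fun Y hY => ?_
    exact if_pos ⟨hY, hV⟩
  case hWdV =>
    by_cases hc : ‖cplxSlice (pts (k i) (Λ i)) (T i) u‖ < R i / 2 ∧ Rg i Vk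
    · simp only [hW, if_pos hc]
      have hu : ‖u‖ < R i := by
        have h1 := hc.1
        rw [norm_cplxSlice] at h1
        linarith [hR i]
      exact (pkg i Vk hc.2).2.2.2 u hu
    · simp only [hW, if_neg hc, reSlice_cplxSlice]
  case hA =>
    have hV' : Rg i Vk := hV
    have h := (pkg i Vk hV).2.1 X δ (hX.trans_lt (hrR i))
    simpa only [LinearMap.id_coe, id_eq, ContinuousLinearMap.coe_coe, hgs, sliceFn_apply, if_pos hV'] using h
  case hJ =>
    by_cases hreg : Rg i Vk
    · rw [if_pos hreg]
      by_cases hle : ε ≤ eR i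
      · exact hJ i ε Vk hε hle hV
      · have h := hJ i (eR i) Vk (heR i) le_rfl hreg
        exact h.trans (mul_le_mul_of_nonneg_left (le_of_lt (lt_of_not_ge hle)) hcJ)
    · rw [if_neg hreg, norm_zero]
      exact mul_nonneg hcJ hε.le

/-- `cplxVec 0 = 0`. [cite: Balaban1989LargeFieldI, Prop. 1 p.194] -/
private theorem cplxVec_zero {k : ℕ} : cplxVec (0 : VecField P k E3) = 0 := by
  funext b; ext i; simp [cplxVec]

/-- The radii of the intrinsic analytic extension (as in `B15Prop1IntrinsicAnalyticAtRecord`, where it is private): with `c = γ/M⁵`, `𝓑 = 4𝓐/R + 1`,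
`rA = min(1/2, R/8, c(R/2)²/(48𝓑))`, `r′ = 2rA`, `εA = min(r′, c·r′·(R/2)/(12𝓑))`, `eJ = c·r′/(6(cJ+1))`, all the smallness conditions of
`anExt_of_jointHolomorphic` hold. [cite: Balaban1989LargeFieldII, (1.13) p.359] -/
private theorem radii_bookkeeping {R 𝓐 γ M cJ : ℝ} (hR : 0 < R) (h𝓐 : 0 ≤ 𝓐) (hγ : 0 < γ) (hM : 1 ≤ M) (hcJ : 0 ≤ cJ) :
    let c := γ / M ^ 5
    let 𝓑 := 4 * 𝓐 / R + 1
    let rA := min (1 / 2) (min (R / 8) (c * (R / 2) ^ 2 / (48 * 𝓑)))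
    let εA := min (2 * rA) (c * (2 * rA) * (R / 2) / (12 * 𝓑))
    let eJ := c * (2 * rA) / (6 * (cJ + 1))
    0 < c ∧ 0 < rA ∧ rA ≤ 1 / 2 ∧ rA < 2 * rA ∧ 2 * rA ≤ R / 4 ∧ 2 * rA ≤ c * (R / 2) ^ 2 / (24 * 𝓑) ∧ 0 < εA ∧ εA ≤ 2 * rA ∧
      εA ≤ c * (2 * rA) * (R / 2) / (12 * 𝓑) ∧ 0 < eJ ∧ cJ * eJ ≤ c * (2 * rA) / 6 := by
  intro c 𝓑 rA εA eJ
  have hM0 : 0 < M := by linarith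
  have hc : 0 < c := by positivity
  have h𝓑 : 0 < 𝓑 := by positivity
  have hrA : 0 < rA := lt_min (by norm_num) (lt_min (by linarith) (by positivity))
  have hrA2 : rA ≤ 1 / 2 := min_le_left _ _
  have hrAR : rA ≤ R / 8 := (min_le_right _ _).trans (min_le_left _ _)
  have hrAc : rA ≤ c * (R / 2) ^ 2 / (48 * 𝓑) := (min_le_right _ _).trans (min_le_right _ _)
  have hεA : 0 < εA := lt_min (by linarith) (by positivity)
  have heJ : 0 < eJ := by positivity
  refine ⟨hc, hrA, hrA2, by linarith, by linarith, ?_, hεA, min_le_left _ _, min_le_right _ _, heJ, ?_⟩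
  · have e : c * (R / 2) ^ 2 / (24 * 𝓑) = 2 * (c * (R / 2) ^ 2 / (48 * 𝓑)) := by field_simp; ring
    rw [e]; linarith
  · have e : cJ * eJ = (cJ / (cJ + 1)) * (c * (2 * rA) / 6) := by
      show cJ * (c * (2 * rA) / (6 * (cJ + 1))) = cJ / (cJ + 1) * (c * (2 * rA) / 6)
      field_simp
    rw [e]
    have h1 : cJ / (cJ + 1) ≤ 1 := by rw [div_le_one (by linarith)]; linarith
    have h2 : 0 ≤ c * (2 * rA) / 6 := by positivity
    calc cJ / (cJ + 1) * (c * (2 * rA) / 6) ≤ 1 * (c * (2 * rA) / 6) := mul_le_mul_of_nonneg_right h1 h2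
      _ = c * (2 * rA) / 6 := one_mul _

/-- **ONE-SIDED (γ₀-generic (1.7)) edition.** ★★ **PROPOSITION 1 [IV] WITH ITS ANALYTIC-EXTENSION CLAUSE, IN THE INTRINSIC READING, OVER A BARE FUNCTION FAMILY** — the twin of
`B15Prop1IntrinsicAnalyticAtRecord.exists_domain_prop1Printed_lfVarOn_std_su2_box_intrinsic_analytic` (p518722) with `A ∘ U_{k,Z}` replaced by `f i`
and (181) by the value invariance `hf`.  The slot `An i := anExt (pts (k i) (Λ i)) (T i) (f i) (ext i) (rA i)`, `rA i = min (1/2) (min (R i/8)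
((γ/M i⁵)(R i/2)²/(48(4𝓐 i/R i + 1))))`; letters (J1) `hGj` (joint holomorphic extension of `(p, B′) ↦ f i (exp(iB′)·ext(exp(ip)V_k))` at `eR`-regular
data, bound `𝓐`), (L2) `h17` + `hsm`∕`hγle`, (L3) `hJ`; `hf`; structural hypotheses. [cite: Balaban1989LargeFieldI, Prop. 1 (1.77)–(1.78) p.194
(incl. the last clause), p.193; Balaban1989LargeFieldII, (1.7)–(1.9) p.358, (1.11)–(1.13) p.359; Balaban1985Variational, Prop. 9 p.309] -/
theorem exists_domain_prop1Printed_lfVarOn_ofFun_intrinsic_analytic_oneSided (hd3 : 3 ≤ P.d) (h0 : 0 < P.d) {ι : Type}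
    (Z Λ : ι → Set (Site P 0)) (k : ι → ℕ) (M : ι → ℝ)
    (f : ∀ i, GaugeField P (k i) SU2 → ℝ)
    (hf : ∀ i (u : GaugeTransf P (k i) SU2) (V : GaugeField P (k i) SU2), f i (gaugeAct u V) = f i V)
    (eR : ι → ℝ) (heR : ∀ i, 0 < eR i)
    (T : ∀ i, Finset (PBond P (k i)))
    (lo hi : ι → Fin P.d → ℤ) (n : ι → ℕ) (hn : ∀ i κ, hi i κ ≤ lo i κ + n i) (hN : ∀ i, n i + 2 < P.sitesPerDir (k i))
    (hbox : ∀ i, pts (k i) (Λ i) = (castSite '' Set.Icc (lo i) (hi i) : Set (Site P (k i))))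
    (hZ : ∀ i, (boxPlaqs (lo i - 1) (hi i + 1) : Set (Plaq P (k i))) ⊆ plaqsInside (pts (k i) (Z i)))
    -- (`G₀`: the image is taken with the classical `DecidableEq` instance, as in p518722's statement — any other instance gives the
    -- same `Finset`, the instances forming a subsingleton)
    (hTG0 : ∀ i, T i = @Finset.image (Fin P.d → ℤ) (PBond P (k i)) (fun a b => Classical.propDecidable (a = b))
      (fun x => (⟨castSite (x - unitVec ⟨0, h0⟩), ⟨0, h0⟩⟩ : PBond P (k i))) (box (fun κ => (hi i κ - lo i κ + 1).toNat) (lo i)))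
    (hN5 : ∀ i κ, ((hi i κ - lo i κ + 1).toNat : ℤ) + 5 < P.sitesPerDir (k i))
    (K : ι → ℕ) (hK1 : ∀ i, 1 ≤ K i) (hKn : ∀ i κ, (hi i κ - lo i κ + 1).toNat ≤ K i)
    (ext : ∀ i, GaugeField P (k i) SU2 → GaugeField P (k i) SU2)
    (hext : ∀ i Vk, ext i Vk = extend (pts (k i) (Λ i)) (shellGauge Vk (lo i) (hi i)) Vk)
    (hlohi : ∀ i, lo i ≤ hi i)
    {γ cJ bx : ℝ} (hγ : 0 < γ) (hcJ : 0 ≤ cJ) (hbx : 0 ≤ bx)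
    (hbxM : ∀ i, 12 * (P.d : ℝ) * ((n i : ℝ) + 2) ^ 2 ≤ bx * (M i) ^ 2)
    {Cerr R 𝓐 : ι → ℝ} (hM : ∀ i, 1 ≤ (M i)) (hR : ∀ i, 0 < R i) (h𝓐 : ∀ i, 0 ≤ 𝓐 i)
    {γ₀ : ℝ} (hγ₀ : 0 ≤ γ₀)
    -- (J1) the JOINT holomorphic extension of the function in the datum perturbation and the field
    (hGj : ∀ i Vk, PlaqSmallOn (plaqsInside (pts (k i) (Z i ∩ (Λ i)ᶜ))) (eR i) Vk →
      ∃ 𝒢 : VecField P (k i) (EuclideanSpace ℂ (Fin 3)) × VecField P (k i) (EuclideanSpace ℂ (Fin 3)) → ℂ,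
        DifferentiableOn ℂ 𝒢 (ball 0 (R i)) ∧
        (∀ z ∈ ball (0 : VecField P (k i) (EuclideanSpace ℂ (Fin 3)) × VecField P (k i) (EuclideanSpace ℂ (Fin 3))) (R i), ‖𝒢 z‖ ≤ 𝓐 i) ∧
        ∀ p B' : VecField P (k i) E3, ‖p‖ < R i → ‖B'‖ < R i →
          𝒢 (cplxVec p, cplxVec B') = ((f i (expMul su2Chart B' (ext i (expMul su2Chart p Vk))) : ℝ) : ℂ))
    -- (L2) (1.7)–(1.9) p.358 for the Hessian of the slice function at `0`
    (h17 : ∀ i Vk, PlaqSmallOn (plaqsInside (pts (k i) (Z i ∩ (Λ i)ᶜ))) (eR i) Vk → ∀ X : GaugeSlice (pts (k i) (Λ i)) (T i) E3,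
      γ₀ * (∑ z ∈ box (fun κ => (hi i κ - lo i κ + 1).toNat + 3) (fun κ => lo i κ - 2), ∑ μ : Fin P.d, ∑ a : Fin 3,
          curl (fun b => ιA (pts (k i) (Λ i)) (T i) X (⟨castSite b.1, b.2⟩ : PBond P (k i)) a) z ⟨0, h0⟩ μ ^ 2) -
        Cerr i * ‖X‖ ^ 2 ≤ ⟪X, (fderiv ℝ (rGrad (pts (k i) (Λ i)) (T i) (sliceFn (pts (k i) (Λ i)) (T i) (f i) (ext i Vk))) 0) X⟫)
    (hsm : ∀ i, Cerr i ≤ γ₀ / (2 * (3 * (K i : ℝ) ^ 2 + 2 * (K i : ℝ) ^ 4)))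
    (hγle : ∀ i, γ / (M i) ^ 5 ≤ γ₀ / (2 * (3 * (K i : ℝ) ^ 2 + 2 * (K i : ℝ) ^ 4)))
    -- (L3) p.359: the gradient at `0` is small at regular data
    (hJ : ∀ i ε Vk, 0 < ε → ε ≤ eR i → PlaqSmallOn (plaqsInside (pts (k i) (Z i ∩ (Λ i)ᶜ))) ε Vk →
      ‖rGrad (pts (k i) (Λ i)) (T i) (sliceFn (pts (k i) (Λ i)) (T i) (f i) (ext i Vk)) 0‖ ≤ cJ * ε)
    : ∃ a₁ : ι → ℝ, (∀ i, 0 < a₁ i) ∧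
      B15.Prop1Printed (lfVarOn su2Chart fun i =>
        (⟨⟨k i, Z i, Λ i, M i, f i, anExt (pts (k i) (Λ i)) (T i) (f i) (ext i)
          (min (1 / 2) (min (R i / 8) (γ / (M i) ^ 5 * (R i / 2) ^ 2 / (48 * (4 * 𝓐 i / R i + 1)))))⟩,
          domReg (Z i) (k i) (a₁ i)⟩ : InstOn P SU2)) := by
  -- the radii
  have hrb := fun i => radii_bookkeeping (hR i) (h𝓐 i) hγ (hM i) hcJ
  set rA : ι → ℝ := fun i => min (1 / 2) (min (R i / 8) (γ / (M i) ^ 5 * (R i / 2) ^ 2 / (48 * (4 * 𝓐 i / R i + 1)))) with hrAdef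
  set εA : ι → ℝ := fun i => min (2 * rA i) (γ / (M i) ^ 5 * (2 * rA i) * (R i / 2) / (12 * (4 * 𝓐 i / R i + 1))) with hεAdef
  set eJ : ι → ℝ := fun i => γ / (M i) ^ 5 * (2 * rA i) / (6 * (cJ + 1)) with heJdef
  set eA : ι → ℝ := fun i => min (eR i) (min (εA i) (eJ i)) with heAdef
  have heA : ∀ i, 0 < eA i := fun i => lt_min (heR i) (lt_min (hrb i).2.2.2.2.2.2.1 (hrb i).2.2.2.2.2.2.2.2.2.1)
  refine exists_domain_prop1Printed_lfVarOn_ofFun_intrinsic_oneSided hd3 h0 Z Λ k M f _ hf eR heR T lo hi n hn hN hbox hZ hTG0 hN5 K hK1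
    hKn ext hext hlohi hγ hcJ hbx hbxM (eA := eA) heA hM hR h𝓐 hγ₀ (fun i Vk hV => ?hGc) h17 hsm hγle hJ (fun i ε Vk hε hεA hV => ?hAn)
  case hGc =>
    -- (L1) is the `p̃ = 0` slice of (J1)
    obtain ⟨𝒢, hd, hb, hr⟩ := hGj i Vk hV
    have h0R : ‖(0 : VecField P (k i) (EuclideanSpace ℂ (Fin 3)))‖ < R i := by rw [norm_zero]; exact hR i
    refine ⟨fun B => 𝒢 (0, B), differentiableOn_section 𝒢 hd h0R, fun Y hY => hb _ ?_, fun B' hB' => ?_⟩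
    · rw [mem_ball_zero_iff] at hY ⊢
      exact norm_prodMk_lt h0R hY
    · have h := hr 0 B' (by rw [norm_zero]; exact hR i) hB'
      rw [cplxVec_zero, expMul_zero] at h
      exact h
  case hAn =>
    -- the datum is `eR`-regular
    have hVR : PlaqSmallOn (plaqsInside (pts (k i) (Z i ∩ (Λ i)ᶜ))) (eR i) Vk := fun q hq =>
      (hV q hq).trans_le (hεA.trans (min_le_left _ _))
    obtain ⟨𝒢, hd, hb, hr⟩ := hGj i Vk hVR
    obtain ⟨hc, hrA0, hrA2, hrr', hr'R, hr'c, hεA0, hεr', hεc, heJ0, hcJe⟩ := hrb i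
    have hεA_le : ε ≤ εA i := hεA.trans ((min_le_right _ _).trans (min_le_left _ _))
    refine anExt_antitone hεA_le ?_
    -- (c3)/(1.12) at the perturbed data, in the intrinsic reading: critical ⇒ the slice gradient vanishes
    have hNw : ∀ κ, hi i κ - lo i κ + 1 < (P.sitesPerDir (k i) : ℤ) := fun κ => by
      have h5 := hN5 i κ
      have : hi i κ - lo i κ + 1 ≤ ((hi i κ - lo i κ + 1).toNat : ℤ) := Int.self_le_toNat _
      linarith
    have hT : TreeOrder (T i) PBond.tgt (boxDepth (lo i - e ⟨0, h0⟩) (hi i)) := by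
      rw [hTG0 i]; exact treeOrder_G0 h0 hNw
    have hv : ∀ b ∈ T i, b.tgt ∈ pts (k i) (Λ i) := fun b hb => by
      rw [hbox i]; rw [hTG0 i] at hb; exact tgt_G0_mem h0 (lo i) (hi i) b hb
    have hf' : ∀ u : GaugeTransf P (k i) SU2, IsGaugeOn (pts (k i) (Λ i)) u → ∀ V, f i (gaugeAct u V) = f i V :=
      fun u _ V => hf i u V
    have hcrit : ∀ p : VecField P (k i) E3, ‖p‖ < R i / 2 → ∀ B : GaugeSlice (pts (k i) (Λ i)) (T i) E3, ‖B‖ ≤ rA i →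
        IsCriticalPt su2Chart (bondsOf (pts (k i) (Λ i))) (f i)
            (expMul su2Chart (ιA (pts (k i) (Λ i)) (T i) B) (ext i (expMul su2Chart p Vk))) →
          rGrad (pts (k i) (Λ i)) (T i) (sliceFn (pts (k i) (Λ i)) (T i) (f i) (ext i (expMul su2Chart p Vk))) B = 0 := by
      intro p hp B hB hcr
      have hpR : ‖p‖ < R i := by linarith [hR i]
      have hpC : ‖cplxVec p‖ < R i := by rw [norm_cplxVec]; exact hpR
      -- the section of `𝒢` at `cplxVec p` extends the function at the perturbed datum
      have hsec := slice_package_of_holomorphic (pts (k i) (Λ i)) (T i) (f i)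
        (ext i (expMul su2Chart p Vk)) (hR i) (fun Bc => 𝒢 (cplxVec p, Bc)) (differentiableOn_section 𝒢 hd hpC)
        (fun Y hY => hb _ (by rw [mem_ball_zero_iff] at hY ⊢; exact norm_prodMk_lt hpC hY))
        (fun B' hB' => hr p B' hpR hB')
      obtain ⟨hdiff, hderiv, -, -⟩ := hsec
      have hBR : ‖B‖ < R i := by linarith [hR i]
      have hB2 : ‖B‖ ≤ 1 / 2 := hB.trans hrA2
      have hX : ∀ b, ‖ιA (pts (k i) (Λ i)) (T i) B b‖ < π := fun b =>
        (norm_ιA_apply_le B b).trans_lt (hB2.trans_lt (by linarith [Real.pi_gt_three]))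
      obtain ⟨D, hD⟩ := exists_hasFDerivAt_of_differentiableAt _ (ext i (expMul su2Chart p Vk)) hX (hdiff B hBR)
      set g := sliceFn (pts (k i) (Λ i)) (T i) (f i) (ext i (expMul su2Chart p Vk)) with hg
      have hiff := isCriticalPt_iff_of_hasDerivAt hT hv hf' (ext i (expMul su2Chart p Vk)) hB2 hD
        (L := fun δ => ⟪δ, rGrad (pts (k i) (Λ i)) (T i) g B⟫_ℝ) (fun δ => by
          have h := hderiv B δ hBR
          rw [← inner_rGrad_eq_taylor] at h
          simpa only [hg, sliceFn_apply] using h)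
      have hall := hiff.1 hcr
      exact inner_self_eq_zero.1 (hall _)
    -- the real (1.9): positivity of the Hessian from (1.7) + (1.67) + (1.8)
    have hpos := hessian_coercive_of_h17 hd3 h0 (hbox i) (hTG0 i) (hN5 i) (hK1 i) (hKn i) hγ₀
      (sliceFn (pts (k i) (Λ i)) (T i) (f i) (ext i Vk)) (h17 i Vk hVR) (hsm i) (hγle i)
    -- the gradient at `0`
    have hj : ‖rGrad (pts (k i) (Λ i)) (T i) (sliceFn (pts (k i) (Λ i)) (T i) (f i) (ext i Vk)) 0‖ ≤ cJ * eA i :=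
      (hJ i ε Vk hε (hεA.trans (min_le_left _ _)) hV).trans (mul_le_mul_of_nonneg_left hεA hcJ)
    have hjc : cJ * eA i ≤ γ / (M i) ^ 5 * (2 * rA i) / 6 :=
      (mul_le_mul_of_nonneg_left ((min_le_right _ _).trans (min_le_right _ _)) hcJ).trans hcJe
    exact anExt_of_jointHolomorphic (pts (k i) (Λ i)) (T i) (f i) (ext i) Vk (hR i) (h𝓐 i) 𝒢 hd hb hr hcrit hc
      hpos hj hrA0 hrr' hr'R hr'c hεr' hεc hjc

end OfFun

end Literature.MathematicalPhysics.QuantumFieldTheory.Balaban1983to89.B15Prop1OneSidedIneq17OfFun
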